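import Literature.AlgebraicGeometry.Deformation.SmoothSchemeLiftObstructionCriterionGlueLineBundle
import Literature.AlgebraicGeometry.Deformation.SmoothSchemeLiftObstructionCriterionGlueLineBundleBaseChange
import Literature.AlgebraicGeometry.Deformation.SmoothSchemeLiftObstructionCriterionGlueLineBundleConverse
import Literature.AlgebraicGeometry.Deformation.SmoothSchemeLiftObstructionCriterion
import Literature.AlgebraicGeometry.Deformation.PairLiftTwistedCocycleReduction
import Literature.AlgebraicGeometry.Deformation.PairLiftTwistedCocycleClosedFibre
import Literature.AlgebraicGeometry.Deformation.PairLiftTwistedCocycleObstructionCocycle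
import Literature.AlgebraicGeometry.Deformation.PairLiftObstructionMove
import HarnessLib

/-!
# Gluing the lifted charts, VI-e: the invertible sheaf along the MOVED lift — pair-lift data of a framed module, and the
# rank-one module on `Glue_R(u·ψ)` with prescribed restriction (Hartshorne DT Thm. 6.4 (a) ⇐ in the dialect of Thm. 10.2;
# Oort §2.3 «choose the lift of the scheme so that `L` extends»)

Layer `Literature/AlgebraicGeometry/Deformation` (cell `hodgecm-mathlib`, F-11 sub-line `F11SmoothRoadA`, α1 grandchild
`F11LiftWithLineBundle`, stub G2 — the LINE-BUNDLE-GLUING composition, RULING (R74) (a); THEOREMS ONLY — no definition, no instance,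
no notation, no named fact).  Sequel of ★ `…GlueLineBundle` (D1-A: exact twisted unit cocycle ↦ rank-one module framed on the chart
images), ★ `…GlueLineBundleConverse` (J2: frames ↦ exact twisted unit cocycle), ★ `…GlueLineBundleBaseChange` (D1-B: base change of
the glued module), ★ `PairLiftTwistedCocycleReduction` / `PairLiftTwistedCocycleClosedFibre` (lifts along `σ ⊗ 1`, closed-fibre units),
★ `PairLiftTwistedCocycleObstruction(Cocycle)` (P1a: the obstruction cochain of the pair and its cocycle identity) and ★
`PairLiftObstructionMove` (P1b: the move `ψ ↦ u·ψ`).  Setting (the `variable` block of D1-B VERBATIM): `k` a field, `X/Spec k` the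
closed fibre with its `k`-structures `halg`, a principal affine cover `U j`, `U j ∩ U l = D(b j l)`, `σ : R ↠ R'` a surjection of
`k`-algebras, lifted gluing data `ψ` over `R` (admissible modulo a nilpotent `𝔫`, cocycle-exact) and `ψ'` over `R'` (modulo `𝔫'`),
compatible under `σ ⊗ 1`.

* §0 two tensor-algebra trivia (`(π₀ ⊗ 1) ∘ (σ ⊗ 1) = π ⊗ 1`; `(σ ⊗ 1)` kills `t ⊗ c` for `t ∈ ker σ`).
* §1 **`exists_pairLiftData_of_frames`** (LB-A).  For `ker σ = J` with `J² = 0`, `J𝔫 = 0`, `e : J ≅ k` (a principal small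
  extension), augmentations `π : R → k`, `π₀ : R' → k` (`π₀ ∘ σ = π`, `π₀(𝔫') = 0`, `ker π ≤ 𝔫`) and a module `M` on
  `X'_{R'} = Glue_{R'}(ψ')` with rank-one frames on the chart images: the exact twisted unit cocycle `G₀` over `R'` reading the frames
  (J2), lifts `G` over `R` (`(σ ⊗ 1) G = G₀`), the closed-fibre units `g = lid ((π₀ ⊗ 1) G₀)` with inverses, `G ≡ 1 ⊗ g (mod 𝔫)`, their
  honest cocycle identity, and the OBSTRUCTION COCHAIN `s` of the pair with its defining identity (P1a) and its fourfold cocycle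
  identity (P1a-B) — «an obstruction in `H²(X, J ⊗ 𝒪_X)`» for extending the invertible sheaf to the given lift `Glue_R(ψ)`.
* §2 **`exists_movedLift_rankOne_pullback_iso`** (LB-B).  If moreover `s = gi·θ(dg) + δh` for a Čech `1`-cocycle `θ` of tangent
  sections (the cup-product input «`[s] = [θ ⌣ dlog g]`», supplied for abelian varieties by Mumford §13 / Oort Lemma 2.3.3 — NOT
  here), then for the automorphisms `u = θ_D` (★ Remark 10.1.1) the MOVED lift `ψ₂ = u·ψ` is admissible, cocycle-exact and reduces to
  `ψ'`, and the corrected units glue (P1b + D1-A) to a RANK-ONE module `L` on `Glue_R(ψ₂)` with `Φ^* L ≅ M` for every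
  change-of-coefficients morphism `Φ : Glue_{R'}(ψ') ⟶ Glue_R(ψ₂)` characterised on the charts (D1-B) — Thm. 6.4 (a) ⇐ along the
  moved lift: «the lift of the scheme can be chosen so that `L` extends» ([Oort1971] §2.3; [MFK94] App. to Ch. 6 §2).

Consumer: the G2 integrator `MONO-G2` (B-p13 (g22)) — between §1 and §2 sit its closed-fibre reading ★ `…GlueLineBundleClosedFibre`
(`g = F.tf` for the reduced frames) and the cup-product socket (I1); after §2, ★ `…GluePullback.exists_baseChangeMap_isPullback` (fed
with the returned `hψσ₂`), the abelian-scheme structure on the lift and ★ `CechPic.pullback_eq_one_of_isLocalRing` (rigidification).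
HC_CM is proved only modulo the 7 printed citations until rung 0 closes — nothing here bears on a summit statement.

## References
* [Hartshorne2010] R. Hartshorne, *Deformation Theory*, GTM 257 (2010): Thm. 6.4 (a) and proof (pp. 50–51), Remark 10.1.1
  (p. 80), Thm. 10.2 (a) proof (p. 81).
* [Oort1971] F. Oort, *Finite group schemes, local moduli for abelian varieties, and lifting problems*, Compositio Math. 23
  (1971), §2.3.
* [Hartshorne1977] R. Hartshorne, *Algebraic Geometry*, GTM 52 (1977): II Ex. 5.18 (b), (c).
* [AtiyahMacdonald1969] M. Atiyah, I. Macdonald, *Introduction to Commutative Algebra* (1969): Prop. 2.18, Ex. 2.2.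
-/

noncomputable section

-- `TopCat.Presheaf`/`TopCat.Sheaf` are not reducible (as in Mathlib's `AlgebraicGeometry/Modules`).
set_option backward.isDefEq.respectTransparency false

open CategoryTheory AlgebraicGeometry Opposite TopologicalSpace Limits
open scoped TensorProduct

universe u

namespace Literature.AlgebraicGeometry.Deformation

section LB

open Literature.AlgebraicGeometry.HodgeTheory Literature.AlgebraicGeometry.Modules
  Literature.AlgebraicGeometry.Motives Literature.AlgebraicGeometry.Morphisms SmoothAffineDeformation

variable {k : Type u} [Field k] {X : Over (Spec (CommRingCat.of k))}
  [instΓ : ∀ W : X.left.Opens, Algebra k Γ(X.left, W)]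
  (halg : ∀ (W : X.left.Opens) (s : k), algebraMap k Γ(X.left, W) s = (constToPresheaf X).app (op W) s)
  {R R' : Type u} [CommRing R] [Algebra k R] [CommRing R'] [Algebra k R'] (σ : R →ₐ[k] R') (hσ : Function.Surjective σ)
  {ι : Type u} (U : ι → X.left.affineOpens) (b : (j l : ι) → Γ(X.left, (U j).1))
  (hb : ∀ j l, (U j).1 ⊓ (U l).1 = X.left.basicOpen (b j l))
  (ψ : (j l : ι) → R ⊗[k] Γ(X.left, (U j).1 ⊓ (U l).1) ≃ₐ[R] R ⊗[k] Γ(X.left, (U j).1 ⊓ (U l).1))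
  (ψ' : (j l : ι) → R' ⊗[k] Γ(X.left, (U j).1 ⊓ (U l).1) ≃ₐ[R'] R' ⊗[k] Γ(X.left, (U j).1 ⊓ (U l).1))
  (𝔫 : Ideal R) (h𝔫 : IsNilpotent 𝔫) (𝔫' : Ideal R') (h𝔫' : IsNilpotent 𝔫')
  (hψ : ∀ j l x, ψ j l x - x ∈ 𝔫 • (⊤ : Submodule R (R ⊗[k] Γ(X.left, (U j).1 ⊓ (U l).1))))
  (hψ' : ∀ j l x, ψ' j l x - x ∈ 𝔫' • (⊤ : Submodule R' (R' ⊗[k] Γ(X.left, (U j).1 ⊓ (U l).1))))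
  (hcoc : ∀ (j l m : ι)
    (Φjl : R ⊗[k] Γ(X.left, (U j).1 ⊓ (U l).1) →ₐ[R] R ⊗[k] Γ(X.left, (U j).1 ⊓ (U l).1 ⊓ (U m).1))
    (_ : ∀ a s, Φjl (a ⊗ₜ s) = a ⊗ₜ X.left.presheaf.map (homOfLE inf_le_left).op s)
    (Φlm : R ⊗[k] Γ(X.left, (U l).1 ⊓ (U m).1) →ₐ[R] R ⊗[k] Γ(X.left, (U j).1 ⊓ (U l).1 ⊓ (U m).1))
    (_ : ∀ a s, Φlm (a ⊗ₜ s) = a ⊗ₜ X.left.presheaf.map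
      (homOfLE (le_inf (inf_le_left.trans inf_le_right) inf_le_right)).op s)
    (Φjm : R ⊗[k] Γ(X.left, (U j).1 ⊓ (U m).1) →ₐ[R] R ⊗[k] Γ(X.left, (U j).1 ⊓ (U l).1 ⊓ (U m).1))
    (_ : ∀ a s, Φjm (a ⊗ₜ s) = a ⊗ₜ X.left.presheaf.map
      (homOfLE (le_inf (inf_le_left.trans inf_le_left) inf_le_right)).op s)
    (ρjl ρlm ρjm : R ⊗[k] Γ(X.left, (U j).1 ⊓ (U l).1 ⊓ (U m).1) ≃ₐ[R]
      R ⊗[k] Γ(X.left, (U j).1 ⊓ (U l).1 ⊓ (U m).1)),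
    (∀ x, ρjl (Φjl x) = Φjl (ψ j l x)) → (∀ x, ρlm (Φlm x) = Φlm (ψ l m x)) →
    (∀ x, ρjm (Φjm x) = Φjm (ψ j m x)) → ρlm * ρjl = ρjm)
  (hcoc' : ∀ (j l m : ι)
    (Φjl : R' ⊗[k] Γ(X.left, (U j).1 ⊓ (U l).1) →ₐ[R'] R' ⊗[k] Γ(X.left, (U j).1 ⊓ (U l).1 ⊓ (U m).1))
    (_ : ∀ a s, Φjl (a ⊗ₜ s) = a ⊗ₜ X.left.presheaf.map (homOfLE inf_le_left).op s)
    (Φlm : R' ⊗[k] Γ(X.left, (U l).1 ⊓ (U m).1) →ₐ[R'] R' ⊗[k] Γ(X.left, (U j).1 ⊓ (U l).1 ⊓ (U m).1))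
    (_ : ∀ a s, Φlm (a ⊗ₜ s) = a ⊗ₜ X.left.presheaf.map
      (homOfLE (le_inf (inf_le_left.trans inf_le_right) inf_le_right)).op s)
    (Φjm : R' ⊗[k] Γ(X.left, (U j).1 ⊓ (U m).1) →ₐ[R'] R' ⊗[k] Γ(X.left, (U j).1 ⊓ (U l).1 ⊓ (U m).1))
    (_ : ∀ a s, Φjm (a ⊗ₜ s) = a ⊗ₜ X.left.presheaf.map
      (homOfLE (le_inf (inf_le_left.trans inf_le_left) inf_le_right)).op s)
    (ρjl ρlm ρjm : R' ⊗[k] Γ(X.left, (U j).1 ⊓ (U l).1 ⊓ (U m).1) ≃ₐ[R']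
      R' ⊗[k] Γ(X.left, (U j).1 ⊓ (U l).1 ⊓ (U m).1)),
    (∀ x, ρjl (Φjl x) = Φjl (ψ' j l x)) → (∀ x, ρlm (Φlm x) = Φlm (ψ' l m x)) →
    (∀ x, ρjm (Φjm x) = Φjm (ψ' j m x)) → ρlm * ρjl = ρjm)
  (hψσ : ∀ j l x, Algebra.TensorProduct.map σ (AlgHom.id k Γ(X.left, (U j).1 ⊓ (U l).1)) (ψ j l x) =
    ψ' j l (Algebra.TensorProduct.map σ (AlgHom.id k Γ(X.left, (U j).1 ⊓ (U l).1)) x))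

/-! ## §0 Two tensor-algebra trivia -/

omit hσ in
/-- `(π₀ ⊗ 1) ∘ (σ ⊗ 1) = (π ⊗ 1)` when `π₀ ∘ σ = π`. [cite: AtiyahMacdonald1969, Prop. 2.18 and Ex. 2.2] -/
theorem map_map_eq_map_of_comp_eq {B : Type u} [CommRing B] [Algebra k B] (π : R →ₐ[k] k) (π₀ : R' →ₐ[k] k)
    (hππ₀ : ∀ a, π₀ (σ a) = π a) (x : R ⊗[k] B) :
    Algebra.TensorProduct.map π₀ (AlgHom.id k B) (Algebra.TensorProduct.map σ (AlgHom.id k B) x) =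
      Algebra.TensorProduct.map π (AlgHom.id k B) x := by
  induction x using TensorProduct.induction_on with
  | zero => simp only [map_zero]
  | tmul a c => simp only [Algebra.TensorProduct.map_tmul, AlgHom.id_apply, hππ₀]
  | add x y hx hy => simp only [map_add, hx, hy]

omit hσ in
/-- `(σ ⊗ 1) (x + t ⊗ c) = (σ ⊗ 1) x` for `t ∈ ker σ`. [cite: AtiyahMacdonald1969, Prop. 2.18 and Ex. 2.2] -/
theorem map_add_tmul_of_map_eq_zero {B : Type u} [CommRing B] [Algebra k B] {t : R} (ht : σ t = 0) (x : R ⊗[k] B) (c : B) :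
    Algebra.TensorProduct.map σ (AlgHom.id k B) (x + t ⊗ₜ c) = Algebra.TensorProduct.map σ (AlgHom.id k B) x := by
  rw [map_add, Algebra.TensorProduct.map_tmul, ht, TensorProduct.zero_tmul, add_zero]

/-! ## §1 (LB-A) From frames on the chart images of `Glue_{R'}(ψ')` to the input block of P1b / SOCKET (I1) -/

set_option maxHeartbeats 400000 in
include hb h𝔫 h𝔫' hψ hψ' hcoc hψσ hσ in
/-- **(LB-A) THE PAIR-LIFT DATA OF A FRAMED RANK-ONE MODULE ON THE DEFORMATION DOWNSTAIRS.**  Setting: `σ : R ↠ R'` with kernel `J`,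
`J² = 0`, `J·𝔫 = 0`, `e : J ≅ k` (a principal small extension), lifted gluing data `ψ` over `R` (admissible modulo the nilpotent
`𝔫`, cocycle-exact) reducing along `σ ⊗ 1` to `ψ'` over `R'`; augmentations `π : R → k`, `π₀ : R' → k` with `π₀ ∘ σ = π`, `π₀(𝔫') = 0`,
`ker π ≤ 𝔫`; a module `M` on `X'_{R'} = Glue_{R'}(ψ')` with rank-one frames `fM j` on the chart images.  CONCLUSION — there are:
units `G₀ j l ∈ R' ⊗ Γ(U j ∩ U l)` with overlap sections `s₀` (chart-`j` reading `G₀ j l`) satisfying the EXACT twisted cocycle identity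
w.r.t. `ψ'` and READING THE FRAMES (`T(fM j, fM l) = (s₀ j l|)`) (★ J2); lifts `G j l` over `R`, `(σ ⊗ 1) G = G₀` (★ §3 of
`PairLiftTwistedCocycleReduction`); the closed-fibre units `g j l = lid ((π₀ ⊗ 1) G₀ j l)` with inverses `gi`, `G ≡ 1 ⊗ g (mod 𝔫)`, the
honest cocycle identity of the `g` (★ `PairLiftTwistedCocycleClosedFibre`); and the OBSTRUCTION COCHAIN `s` of the pair with its
defining identity (★ P1a `exists_pairObstructionCochain`, fed by brick B6 = ★ `twistedDefect_sub_one_mem_of_map_eq`) and its fourfold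
cocycle identity (★ P1a-B `pairObstructionCochain_cocycle`) — the last is the hypothesis `hs` of SOCKET (I1), the rest the input
block of ★ P1b `exact_correctedUnits_of_move` and of (LB-B). [cite: Hartshorne2010, Thm. 6.4 (a) and proof, pp. 50–51]
[cite: Hartshorne1977, II Ex. 5.18 (b)] [cite: Oort1971, §2.3] [cite: AtiyahMacdonald1969, Prop. 2.18 and Ex. 2.2] -/
theorem exists_pairLiftData_of_frames (J : Ideal R) (hJσ : ∀ a, σ a = 0 ↔ a ∈ J) (hJ : J * J = ⊥) (hJ𝔫 : J * 𝔫 = ⊥)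
    (e : ↥(J.restrictScalars k) ≃ₗ[k] k) (π : R →ₐ[k] k) (π₀ : R' →ₐ[k] k) (hππ₀ : ∀ a, π₀ (σ a) = π a)
    (h𝔫'π₀ : ∀ r ∈ 𝔫', π₀ r = 0) (h𝔫π : ∀ a, π a = 0 → a ∈ 𝔫)
    (M : (deformationGlueDatum halg R' U b hb ψ' 𝔫' h𝔫' hψ' hcoc').glueData.glued.Modules)
    (fM : ∀ j, SheafOfModules.free (PUnit : Type u) ≅ M.over ((deformationGlueDatum halg R' U b hb ψ' 𝔫' h𝔫' hψ' hcoc').glueData.ι j).opensRange) :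
    ∃ (G₀ : (j l : ι) → R' ⊗[k] Γ(X.left, (U j).1 ⊓ (U l).1))
      (s₀ : (j l : ι) →
        Γ((deformationGlueDatum halg R' U b hb ψ' 𝔫' h𝔫' hψ' hcoc').glueData.glued,
          ((deformationGlueDatum halg R' U b hb ψ' 𝔫' h𝔫' hψ' hcoc').glueData.ι j).opensRange ⊓
            ((deformationGlueDatum halg R' U b hb ψ' 𝔫' h𝔫' hψ' hcoc').glueData.ι l).opensRange))
      (G : (j l : ι) → R ⊗[k] Γ(X.left, (U j).1 ⊓ (U l).1))
      (g gi : (j l : ι) → Γ(X.left, (U j).1 ⊓ (U l).1))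
      (s : (j l m : ι) → Γ(X.left, (U j).1 ⊓ (U l).1 ⊓ (U m).1)),
      (∀ j l, IsUnit (G₀ j l)) ∧
      (∀ j l, ((chartOverlap R' U j l).ι ≫ (deformationGlueDatum halg R' U b hb ψ' 𝔫' h𝔫' hψ' hcoc').glueData.ι j).appLE
          (((deformationGlueDatum halg R' U b hb ψ' 𝔫' h𝔫' hψ' hcoc').glueData.ι j).opensRange ⊓
            ((deformationGlueDatum halg R' U b hb ψ' 𝔫' h𝔫' hψ' hcoc').glueData.ι l).opensRange) ⊤
          (top_le_preimage_opensRange_inf halg R' U b hb ψ' 𝔫' h𝔫' hψ' hcoc' j l) (s₀ j l) =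
        overlapRingHom halg R' U j l (G₀ j l)) ∧
      (∀ (j l m : ι)
        (Φjl : R' ⊗[k] Γ(X.left, (U j).1 ⊓ (U l).1) →ₐ[R'] R' ⊗[k] Γ(X.left, (U j).1 ⊓ (U l).1 ⊓ (U m).1))
        (_ : ∀ a s, Φjl (a ⊗ₜ s) = a ⊗ₜ X.left.presheaf.map (homOfLE inf_le_left).op s)
        (Φlm : R' ⊗[k] Γ(X.left, (U l).1 ⊓ (U m).1) →ₐ[R'] R' ⊗[k] Γ(X.left, (U j).1 ⊓ (U l).1 ⊓ (U m).1))
        (_ : ∀ a s, Φlm (a ⊗ₜ s) = a ⊗ₜ X.left.presheaf.map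
          (homOfLE (le_inf (inf_le_left.trans inf_le_right) inf_le_right)).op s)
        (Φjm : R' ⊗[k] Γ(X.left, (U j).1 ⊓ (U m).1) →ₐ[R'] R' ⊗[k] Γ(X.left, (U j).1 ⊓ (U l).1 ⊓ (U m).1))
        (_ : ∀ a s, Φjm (a ⊗ₜ s) = a ⊗ₜ X.left.presheaf.map
          (homOfLE (le_inf (inf_le_left.trans inf_le_left) inf_le_right)).op s)
        (τjl : R' ⊗[k] Γ(X.left, (U j).1 ⊓ (U l).1 ⊓ (U m).1) ≃ₐ[R'] R' ⊗[k] Γ(X.left, (U j).1 ⊓ (U l).1 ⊓ (U m).1)),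
        (∀ x, τjl (Φjl (ψ' j l x)) = Φjl x) → Φjm (G₀ j m) = Φjl (G₀ j l) * τjl (Φlm (G₀ l m))) ∧
      (∀ (j l : ι) (V : (deformationGlueDatum halg R' U b hb ψ' 𝔫' h𝔫' hψ' hcoc').glueData.glued.Opens)
        (hj : V ≤ ((deformationGlueDatum halg R' U b hb ψ' 𝔫' h𝔫' hψ' hcoc').glueData.ι j).opensRange)
        (hl : V ≤ ((deformationGlueDatum halg R' U b hb ψ' 𝔫' h𝔫' hψ' hcoc').glueData.ι l).opensRange),
        transition (fM j) (fM l) (homOfLE hj) (homOfLE hl) =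
          Matrix.of fun _ _ => secRes (deformationGlueDatum halg R' U b hb ψ' 𝔫' h𝔫' hψ' hcoc').glueData.glued
            (le_inf hj hl) (s₀ j l)) ∧
      (∀ j l, Algebra.TensorProduct.map σ (AlgHom.id k Γ(X.left, (U j).1 ⊓ (U l).1)) (G j l) = G₀ j l) ∧
      (∀ j l, g j l = Algebra.TensorProduct.lid k Γ(X.left, (U j).1 ⊓ (U l).1)
        (Algebra.TensorProduct.map π₀ (AlgHom.id k Γ(X.left, (U j).1 ⊓ (U l).1)) (G₀ j l))) ∧
      (∀ j l, IsUnit (g j l)) ∧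
      (∀ j l, g j l * gi j l = 1) ∧
      (∀ j l, G j l - (1 : R) ⊗ₜ g j l ∈ 𝔫 • (⊤ : Submodule R (R ⊗[k] Γ(X.left, (U j).1 ⊓ (U l).1)))) ∧
      (∀ j l m : ι,
        X.left.presheaf.map (homOfLE (inf_le_left : (U j).1 ⊓ (U l).1 ⊓ (U m).1 ≤ (U j).1 ⊓ (U l).1)).op (g j l) *
          X.left.presheaf.map (homOfLE (le_inf (inf_le_left.trans inf_le_right) inf_le_right :
            (U j).1 ⊓ (U l).1 ⊓ (U m).1 ≤ (U l).1 ⊓ (U m).1)).op (g l m) =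
          X.left.presheaf.map (homOfLE (le_inf (inf_le_left.trans inf_le_left) inf_le_right :
            (U j).1 ⊓ (U l).1 ⊓ (U m).1 ≤ (U j).1 ⊓ (U m).1)).op (g j m)) ∧
      (∀ (j l m : ι)
        (Φjl : R ⊗[k] Γ(X.left, (U j).1 ⊓ (U l).1) →ₐ[R] R ⊗[k] Γ(X.left, (U j).1 ⊓ (U l).1 ⊓ (U m).1))
        (_ : ∀ a s, Φjl (a ⊗ₜ s) = a ⊗ₜ X.left.presheaf.map (homOfLE inf_le_left).op s)
        (Φlm : R ⊗[k] Γ(X.left, (U l).1 ⊓ (U m).1) →ₐ[R] R ⊗[k] Γ(X.left, (U j).1 ⊓ (U l).1 ⊓ (U m).1))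
        (_ : ∀ a s, Φlm (a ⊗ₜ s) = a ⊗ₜ X.left.presheaf.map
          (homOfLE (le_inf (inf_le_left.trans inf_le_right) inf_le_right)).op s)
        (Φjm : R ⊗[k] Γ(X.left, (U j).1 ⊓ (U m).1) →ₐ[R] R ⊗[k] Γ(X.left, (U j).1 ⊓ (U l).1 ⊓ (U m).1))
        (_ : ∀ a s, Φjm (a ⊗ₜ s) = a ⊗ₜ X.left.presheaf.map
          (homOfLE (le_inf (inf_le_left.trans inf_le_left) inf_le_right)).op s)
        (τjl : R ⊗[k] Γ(X.left, (U j).1 ⊓ (U l).1 ⊓ (U m).1) ≃ₐ[R] R ⊗[k] Γ(X.left, (U j).1 ⊓ (U l).1 ⊓ (U m).1)),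
        (∀ x, τjl (Φjl (ψ j l x)) = Φjl x) →
        Φjm (G j m) * (1 + ((e.symm 1 : ↥(J.restrictScalars k)) : R) ⊗ₜ s j l m) = Φjl (G j l) * τjl (Φlm (G l m))) ∧
      (∀ j l m n : ι,
        X.left.presheaf.map (homOfLE (le_inf (le_inf (inf_le_left.trans (inf_le_left.trans inf_le_right))
              (inf_le_left.trans inf_le_right)) inf_le_right :
            (U j).1 ⊓ (U l).1 ⊓ (U m).1 ⊓ (U n).1 ≤ (U l).1 ⊓ (U m).1 ⊓ (U n).1)).op (s l m n) -
          X.left.presheaf.map (homOfLE (le_inf (le_inf (inf_le_left.trans (inf_le_left.trans inf_le_left))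
              (inf_le_left.trans inf_le_right)) inf_le_right :
            (U j).1 ⊓ (U l).1 ⊓ (U m).1 ⊓ (U n).1 ≤ (U j).1 ⊓ (U m).1 ⊓ (U n).1)).op (s j m n) +
          X.left.presheaf.map (homOfLE (le_inf (inf_le_left.trans inf_le_left) inf_le_right :
            (U j).1 ⊓ (U l).1 ⊓ (U m).1 ⊓ (U n).1 ≤ (U j).1 ⊓ (U l).1 ⊓ (U n).1)).op (s j l n) -
          X.left.presheaf.map (homOfLE (inf_le_left :
            (U j).1 ⊓ (U l).1 ⊓ (U m).1 ⊓ (U n).1 ≤ (U j).1 ⊓ (U l).1 ⊓ (U m).1)).op (s j l m) = 0) := by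
  -- `J = ker σ`
  have hJσ' : RingHom.ker σ = J := Ideal.ext fun a => by rw [RingHom.mem_ker]; exact hJσ a
  subst hJσ'
  have hπ₀ : Function.Surjective π₀ := fun s => ⟨algebraMap k R' s, π₀.commutes s⟩
  -- ★ J2: the exact twisted unit cocycle `G₀` downstairs and its overlap sections `s₀` reading the frames
  obtain ⟨G₀, s₀, hG₀u, hs₀, hG₀coc, hfM⟩ :=
    exists_twistedCocycle_of_frames halg R' U b hb ψ' 𝔫' h𝔫' hψ' hcoc' M fM
  -- lifts along `σ ⊗ 1` and brick B6
  obtain ⟨G, hGσ⟩ := exists_map_eq σ hσ U G₀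
  have hGcocJ := twistedDefect_sub_one_mem_of_map_eq halg σ hσ U b hb ψ ψ' 𝔫' h𝔫' hψ' hψσ G₀ hG₀u hG₀coc G hGσ
  -- brick B9: the closed-fibre units
  have hψ'π₀ : ∀ j l x, Algebra.TensorProduct.map π₀ (AlgHom.id k Γ(X.left, (U j).1 ⊓ (U l).1)) (ψ' j l x) =
      (fun _ _ => (AlgEquiv.refl : k ⊗[k] Γ(X.left, (U j).1 ⊓ (U l).1) ≃ₐ[k] k ⊗[k] Γ(X.left, (U j).1 ⊓ (U l).1))) j l
        (Algebra.TensorProduct.map π₀ (AlgHom.id k Γ(X.left, (U j).1 ⊓ (U l).1)) x) := by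
    intro j l x
    rw [AlgEquiv.coe_refl, id_eq, ← sub_eq_zero, ← map_sub, ← mem_smul_top_iff_map_eq_zero π₀ hπ₀]
    exact Submodule.smul_mono (fun r hr => (RingHom.mem_ker).2 (h𝔫'π₀ r hr)) le_rfl (hψ' j l x)
  have hg₀coc := twistedCocycle_map_of_twistedCocycle halg π₀ U b hb ψ' 𝔫' h𝔫' hψ' (fun _ _ => AlgEquiv.refl) hψ'π₀ G₀ hG₀coc
  have hgcoc := cocycle_lid_of_twistedCocycle_one halg U b hb
    (fun j l => Algebra.TensorProduct.map π₀ (AlgHom.id k Γ(X.left, (U j).1 ⊓ (U l).1)) (G₀ j l)) hg₀coc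
  have hg : ∀ j l, IsUnit (Algebra.TensorProduct.lid k Γ(X.left, (U j).1 ⊓ (U l).1)
      (Algebra.TensorProduct.map π₀ (AlgHom.id k Γ(X.left, (U j).1 ⊓ (U l).1)) (G₀ j l))) := fun j l =>
    isUnit_lid_map π₀ (hG₀u j l)
  have hG : ∀ j l, G j l - (1 : R) ⊗ₜ Algebra.TensorProduct.lid k Γ(X.left, (U j).1 ⊓ (U l).1)
      (Algebra.TensorProduct.map π₀ (AlgHom.id k Γ(X.left, (U j).1 ⊓ (U l).1)) (G₀ j l)) ∈
        𝔫 • (⊤ : Submodule R (R ⊗[k] Γ(X.left, (U j).1 ⊓ (U l).1))) := by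
    intro j l
    rw [← hGσ j l, map_map_eq_map_of_comp_eq σ π π₀ hππ₀]
    exact Submodule.smul_mono (fun a ha => h𝔫π a ((RingHom.mem_ker).1 ha)) le_rfl (sub_one_tmul_lid_mem π (G j l))
  -- ★ P1a and ★ P1a-B
  obtain ⟨s, hs⟩ := exists_pairObstructionCochain halg U b hb (RingHom.ker σ) 𝔫 e h𝔫 ψ hψ G _ hg hG hGcocJ
  have hs4 := pairObstructionCochain_cocycle halg U b hb (RingHom.ker σ) 𝔫 e h𝔫 hJ hJ𝔫 ψ hψ hcoc G _ hg hG s hs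
  exact ⟨G₀, s₀, G, _, fun j l => ((hg j l).unit⁻¹ : (Γ(X.left, (U j).1 ⊓ (U l).1))ˣ).val, s, hG₀u, hs₀, hG₀coc, hfM, hGσ,
    fun _ _ => rfl, hg, fun j l => (hg j l).mul_val_inv, hG, hgcoc, hs, hs4⟩

/-! ## §2 (LB-B) From the pair-lift data and the output of SOCKET (I1) to the rank-one module on the moved lift -/

set_option maxHeartbeats 400000 in -- as ★ D1-B `appLE_baseChangeMap_overlapSection`: the final D1-B application unifies the chart-level shapes
include hb h𝔫 h𝔫' hψ hψ' hcoc hψσ hσ in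
/-- **(LB-B) THE MOVED LIFT AND ITS RANK-ONE MODULE, WITH THE PRESCRIBED RESTRICTION DOWNSTAIRS.**  In the setting of (LB-A) (and
`J ≤ 𝔫`), take its output block (`G₀ s₀ G g gi s` with `hs₀ hfM hGσ hgi hG hgcoc hs`) and the output of SOCKET (I1) for the cochain
`s`: tangent sections `θ j l` forming a Čech `1`-cocycle and a `1`-cochain `h` with `s = gi·θ(dg) + δh` (`hsh`).  THEN: for the
automorphisms `u j l = θ_D` represented by the `θ j l` (★ B7 `exists_algEquiv_of_tangentSheaf_section`, `u ≡ 1 (mod J)`) the MOVED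
LIFT `ψ₂ := u · ψ` is admissible modulo `𝔫` and cocycle-exact (★ `movedLifts_sub_mem`, `movedLifts_cocycle`) and REDUCES TO `ψ'`
along `σ ⊗ 1` (brick B8: `u ≡ 1 (mod ker σ)`); the corrected units `G' = G + t ⊗ (g·h)` are an EXACT twisted unit cocycle w.r.t.
`ψ₂` (★ P1b `exact_correctedUnits_of_move`), so they glue to a RANK-ONE module `L` on `X'_R := Glue_R(ψ₂)` framed on the chart images
(★ D1-A `exists_rankOne_frames_of_twistedCocycle`); and since `(σ ⊗ 1) G' = (σ ⊗ 1) G = G₀` reads the frames of `M`, `Φ^* L ≅ M` for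
every change-of-coefficients morphism `Φ : Glue_{R'}(ψ') ⟶ Glue_R(ψ₂)` characterised on the charts (★ D1-B
`nonempty_pullback_iso_of_overlapSections`; `Φ` from ★ 4b/S5 `exists_baseChangeMap_isPullback`, fed with the returned `hψσ₂`).  This is
«choose the lift of the scheme so that `L` extends, and extend it» ([Oort1971] §2.3; [Hartshorne2010] Thm. 6.4 (a) ⇐).
[cite: Hartshorne2010, Thm. 6.4 (a) and proof, pp. 50–51] [cite: Hartshorne2010, Remark 10.1.1, p. 80] [cite: Oort1971, §2.3]
[cite: Hartshorne1977, II Ex. 5.18 (b), (c)] -/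
theorem exists_movedLift_rankOne_pullback_iso (J : Ideal R) (hJσ : ∀ a, σ a = 0 ↔ a ∈ J) (hJ : J * J = ⊥) (hJ𝔫 : J * 𝔫 = ⊥)
    (hJle : J ≤ 𝔫) (e : ↥(J.restrictScalars k) ≃ₗ[k] k)
    (M : (deformationGlueDatum halg R' U b hb ψ' 𝔫' h𝔫' hψ' hcoc').glueData.glued.Modules)
    (fM : ∀ j, SheafOfModules.free (PUnit : Type u) ≅ M.over ((deformationGlueDatum halg R' U b hb ψ' 𝔫' h𝔫' hψ' hcoc').glueData.ι j).opensRange)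
    (G₀ : (j l : ι) → R' ⊗[k] Γ(X.left, (U j).1 ⊓ (U l).1))
    (s₀ : (j l : ι) →
      Γ((deformationGlueDatum halg R' U b hb ψ' 𝔫' h𝔫' hψ' hcoc').glueData.glued,
        ((deformationGlueDatum halg R' U b hb ψ' 𝔫' h𝔫' hψ' hcoc').glueData.ι j).opensRange ⊓
          ((deformationGlueDatum halg R' U b hb ψ' 𝔫' h𝔫' hψ' hcoc').glueData.ι l).opensRange))
    (hs₀ : ∀ j l, ((chartOverlap R' U j l).ι ≫ (deformationGlueDatum halg R' U b hb ψ' 𝔫' h𝔫' hψ' hcoc').glueData.ι j).appLE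
          (((deformationGlueDatum halg R' U b hb ψ' 𝔫' h𝔫' hψ' hcoc').glueData.ι j).opensRange ⊓
            ((deformationGlueDatum halg R' U b hb ψ' 𝔫' h𝔫' hψ' hcoc').glueData.ι l).opensRange) ⊤
          (top_le_preimage_opensRange_inf halg R' U b hb ψ' 𝔫' h𝔫' hψ' hcoc' j l) (s₀ j l) =
        overlapRingHom halg R' U j l (G₀ j l))
    (hfM : ∀ (j l : ι) (V : (deformationGlueDatum halg R' U b hb ψ' 𝔫' h𝔫' hψ' hcoc').glueData.glued.Opens)
      (hj : V ≤ ((deformationGlueDatum halg R' U b hb ψ' 𝔫' h𝔫' hψ' hcoc').glueData.ι j).opensRange)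
      (hl : V ≤ ((deformationGlueDatum halg R' U b hb ψ' 𝔫' h𝔫' hψ' hcoc').glueData.ι l).opensRange),
      transition (fM j) (fM l) (homOfLE hj) (homOfLE hl) =
        Matrix.of fun _ _ => secRes (deformationGlueDatum halg R' U b hb ψ' 𝔫' h𝔫' hψ' hcoc').glueData.glued
          (le_inf hj hl) (s₀ j l))
    (G : (j l : ι) → R ⊗[k] Γ(X.left, (U j).1 ⊓ (U l).1))
    (hGσ : ∀ j l, Algebra.TensorProduct.map σ (AlgHom.id k Γ(X.left, (U j).1 ⊓ (U l).1)) (G j l) = G₀ j l)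
    (g gi : (j l : ι) → Γ(X.left, (U j).1 ⊓ (U l).1)) (hgi : ∀ j l, g j l * gi j l = 1)
    (hG : ∀ j l, G j l - (1 : R) ⊗ₜ g j l ∈ 𝔫 • (⊤ : Submodule R (R ⊗[k] Γ(X.left, (U j).1 ⊓ (U l).1))))
    (hgcoc : ∀ j l m : ι,
      X.left.presheaf.map (homOfLE (inf_le_left : (U j).1 ⊓ (U l).1 ⊓ (U m).1 ≤ (U j).1 ⊓ (U l).1)).op (g j l) *
        X.left.presheaf.map (homOfLE (le_inf (inf_le_left.trans inf_le_right) inf_le_right :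
          (U j).1 ⊓ (U l).1 ⊓ (U m).1 ≤ (U l).1 ⊓ (U m).1)).op (g l m) =
        X.left.presheaf.map (homOfLE (le_inf (inf_le_left.trans inf_le_left) inf_le_right :
          (U j).1 ⊓ (U l).1 ⊓ (U m).1 ≤ (U j).1 ⊓ (U m).1)).op (g j m))
    (s : (j l m : ι) → Γ(X.left, (U j).1 ⊓ (U l).1 ⊓ (U m).1))
    (hs : ∀ (j l m : ι)
      (Φjl : R ⊗[k] Γ(X.left, (U j).1 ⊓ (U l).1) →ₐ[R] R ⊗[k] Γ(X.left, (U j).1 ⊓ (U l).1 ⊓ (U m).1))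
      (_ : ∀ a s, Φjl (a ⊗ₜ s) = a ⊗ₜ X.left.presheaf.map (homOfLE inf_le_left).op s)
      (Φlm : R ⊗[k] Γ(X.left, (U l).1 ⊓ (U m).1) →ₐ[R] R ⊗[k] Γ(X.left, (U j).1 ⊓ (U l).1 ⊓ (U m).1))
      (_ : ∀ a s, Φlm (a ⊗ₜ s) = a ⊗ₜ X.left.presheaf.map
        (homOfLE (le_inf (inf_le_left.trans inf_le_right) inf_le_right)).op s)
      (Φjm : R ⊗[k] Γ(X.left, (U j).1 ⊓ (U m).1) →ₐ[R] R ⊗[k] Γ(X.left, (U j).1 ⊓ (U l).1 ⊓ (U m).1))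
      (_ : ∀ a s, Φjm (a ⊗ₜ s) = a ⊗ₜ X.left.presheaf.map
        (homOfLE (le_inf (inf_le_left.trans inf_le_left) inf_le_right)).op s)
      (τjl : R ⊗[k] Γ(X.left, (U j).1 ⊓ (U l).1 ⊓ (U m).1) ≃ₐ[R] R ⊗[k] Γ(X.left, (U j).1 ⊓ (U l).1 ⊓ (U m).1)),
      (∀ x, τjl (Φjl (ψ j l x)) = Φjl x) →
      Φjm (G j m) * (1 + ((e.symm 1 : ↥(J.restrictScalars k)) : R) ⊗ₜ s j l m) = Φjl (G j l) * τjl (Φlm (G l m)))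
    (θ : (j l : ι) → ((cotangentSheaf X).over ((U j).1 ⊓ (U l).1) ⟶ (unitModule X.left).over ((U j).1 ⊓ (U l).1)))
    (hθcoc : ∀ j l m : ι,
      restrictHom (homOfLE (inf_le_left : (U j).1 ⊓ (U l).1 ⊓ (U m).1 ≤ (U j).1 ⊓ (U l).1)) (θ j l) +
        restrictHom (homOfLE (le_inf (inf_le_left.trans inf_le_right) inf_le_right :
          (U j).1 ⊓ (U l).1 ⊓ (U m).1 ≤ (U l).1 ⊓ (U m).1)) (θ l m) =
        restrictHom (homOfLE (le_inf (inf_le_left.trans inf_le_left) inf_le_right :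
          (U j).1 ⊓ (U l).1 ⊓ (U m).1 ≤ (U j).1 ⊓ (U m).1)) (θ j m))
    (h : (j l : ι) → Γ(X.left, (U j).1 ⊓ (U l).1))
    (hsh : ∀ j l m : ι, s j l m =
      X.left.presheaf.map (homOfLE (le_inf (inf_le_left.trans inf_le_right) inf_le_right :
          (U j).1 ⊓ (U l).1 ⊓ (U m).1 ≤ (U l).1 ⊓ (U m).1)).op (gi l m) *
        (show Γ(X.left, (U j).1 ⊓ (U l).1 ⊓ (U m).1) from
          appLE (restrictHom (homOfLE (inf_le_left : (U j).1 ⊓ (U l).1 ⊓ (U m).1 ≤ (U j).1 ⊓ (U l).1)) (θ j l)) (𝟙 _)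
            (dSection X _ (X.left.presheaf.map (homOfLE (le_inf (inf_le_left.trans inf_le_right) inf_le_right :
              (U j).1 ⊓ (U l).1 ⊓ (U m).1 ≤ (U l).1 ⊓ (U m).1)).op (g l m)))) +
      (X.left.presheaf.map (homOfLE (le_inf (inf_le_left.trans inf_le_left) inf_le_right :
          (U j).1 ⊓ (U l).1 ⊓ (U m).1 ≤ (U j).1 ⊓ (U m).1)).op (h j m) -
        X.left.presheaf.map (homOfLE (inf_le_left : (U j).1 ⊓ (U l).1 ⊓ (U m).1 ≤ (U j).1 ⊓ (U l).1)).op (h j l) -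
        X.left.presheaf.map (homOfLE (le_inf (inf_le_left.trans inf_le_right) inf_le_right :
          (U j).1 ⊓ (U l).1 ⊓ (U m).1 ≤ (U l).1 ⊓ (U m).1)).op (h l m))) :
    ∃ (u : (j l : ι) → R ⊗[k] Γ(X.left, (U j).1 ⊓ (U l).1) ≃ₐ[R] R ⊗[k] Γ(X.left, (U j).1 ⊓ (U l).1))
      (_ : ∀ j l x, u j l x - x ∈ J • (⊤ : Submodule R (R ⊗[k] Γ(X.left, (U j).1 ⊓ (U l).1))))
      (hψ₂ : ∀ j l x, (u j l * ψ j l) x - x ∈ 𝔫 • (⊤ : Submodule R (R ⊗[k] Γ(X.left, (U j).1 ⊓ (U l).1))))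
      (hcoc₂ : ∀ (j l m : ι)
        (Φjl : R ⊗[k] Γ(X.left, (U j).1 ⊓ (U l).1) →ₐ[R] R ⊗[k] Γ(X.left, (U j).1 ⊓ (U l).1 ⊓ (U m).1))
        (_ : ∀ a s, Φjl (a ⊗ₜ s) = a ⊗ₜ X.left.presheaf.map (homOfLE inf_le_left).op s)
        (Φlm : R ⊗[k] Γ(X.left, (U l).1 ⊓ (U m).1) →ₐ[R] R ⊗[k] Γ(X.left, (U j).1 ⊓ (U l).1 ⊓ (U m).1))
        (_ : ∀ a s, Φlm (a ⊗ₜ s) = a ⊗ₜ X.left.presheaf.map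
          (homOfLE (le_inf (inf_le_left.trans inf_le_right) inf_le_right)).op s)
        (Φjm : R ⊗[k] Γ(X.left, (U j).1 ⊓ (U m).1) →ₐ[R] R ⊗[k] Γ(X.left, (U j).1 ⊓ (U l).1 ⊓ (U m).1))
        (_ : ∀ a s, Φjm (a ⊗ₜ s) = a ⊗ₜ X.left.presheaf.map
          (homOfLE (le_inf (inf_le_left.trans inf_le_left) inf_le_right)).op s)
        (ρjl ρlm ρjm : R ⊗[k] Γ(X.left, (U j).1 ⊓ (U l).1 ⊓ (U m).1) ≃ₐ[R]
          R ⊗[k] Γ(X.left, (U j).1 ⊓ (U l).1 ⊓ (U m).1)),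
        (∀ x, ρjl (Φjl x) = Φjl ((u j l * ψ j l) x)) → (∀ x, ρlm (Φlm x) = Φlm ((u l m * ψ l m) x)) →
        (∀ x, ρjm (Φjm x) = Φjm ((u j m * ψ j m) x)) → ρlm * ρjl = ρjm)
      (L : (deformationGlueDatum halg R U b hb (fun j l => u j l * ψ j l) 𝔫 h𝔫 hψ₂ hcoc₂).glueData.glued.Modules)
      (_ : HasRank L 1),
      (∀ j l x, Algebra.TensorProduct.map σ (AlgHom.id k Γ(X.left, (U j).1 ⊓ (U l).1)) ((u j l * ψ j l) x) =
        ψ' j l (Algebra.TensorProduct.map σ (AlgHom.id k Γ(X.left, (U j).1 ⊓ (U l).1)) x)) ∧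
      ∀ (Φ : (deformationGlueDatum halg R' U b hb ψ' 𝔫' h𝔫' hψ' hcoc').glueData.glued ⟶ (deformationGlueDatum halg R U b hb (fun j l => u j l * ψ j l) 𝔫 h𝔫 hψ₂ hcoc₂).glueData.glued)
        (_ : ∀ j, (deformationGlueDatum halg R' U b hb ψ' 𝔫' h𝔫' hψ' hcoc').glueData.ι j ≫ Φ =
          Spec.map (CommRingCat.ofHom (Algebra.TensorProduct.map σ (AlgHom.id k Γ(X.left, (U j).1))).toRingHom) ≫
            (deformationGlueDatum halg R U b hb (fun j l => u j l * ψ j l) 𝔫 h𝔫 hψ₂ hcoc₂).glueData.ι j),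
        Nonempty ((Scheme.Modules.pullback Φ).obj L ≅ M) := by
  -- `J = ker σ`
  have hJσ' : RingHom.ker σ = J := Ideal.ext fun a => by rw [RingHom.mem_ker]; exact hJσ a
  have ht : σ ((e.symm 1 : ↥(J.restrictScalars k)) : R) = 0 := (hJσ _).2 (e.symm 1).2
  -- ★ B7: the moving automorphisms `u j l = θ_D`
  have hu := fun j l => exists_algEquiv_of_tangentSheaf_section (X := X) halg J hJ e (W := (U j).1 ⊓ (U l).1) (θ j l)
  choose u hurep huJ using hu
  have hψ₂ : ∀ j l x, (u j l * ψ j l) x - x ∈ 𝔫 • (⊤ : Submodule R (R ⊗[k] Γ(X.left, (U j).1 ⊓ (U l).1))) :=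
    fun j l x => movedLifts_sub_mem J 𝔫 hJle (huJ j l) (hψ j l) x
  have hcoc₂ := movedLifts_cocycle halg J hJ e U b hb 𝔫 h𝔫 hJ𝔫 ψ hψ hcoc u huJ θ hurep hθcoc
  -- ★ P1b: the corrected units are an exact twisted cocycle w.r.t. the moved lift
  obtain ⟨hG'𝔫, hG'coc⟩ :=
    exact_correctedUnits_of_move halg J hJ e U b hb 𝔫 h𝔫 hJ𝔫 hJle ψ hψ u huJ θ hurep G g gi hgi hG hgcoc s hs h hsh
  have hg : ∀ j l, IsUnit (g j l) := fun j l => IsUnit.of_mul_eq_one (gi j l) (hgi j l)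
  have hG'u : ∀ j l, IsUnit (G j l + ((e.symm 1 : ↥(J.restrictScalars k)) : R) ⊗ₜ (g j l * h j l)) := fun j l =>
    isUnit_of_sub_tmul_mem h𝔫 (hg j l) (hG'𝔫 j l)
  -- ★ D1-A: the rank-one module on `Glue_R(u·ψ)` glued from the corrected units
  obtain ⟨s₂, hs₂⟩ := exists_overlapSections halg R U b hb (fun j l => u j l * ψ j l) 𝔫 h𝔫 hψ₂ hcoc₂
    (fun j l => G j l + ((e.symm 1 : ↥(J.restrictScalars k)) : R) ⊗ₜ (g j l * h j l))
  obtain ⟨L, hL, e₂, he₂⟩ := exists_rankOne_frames_of_twistedCocycle halg R U b hb (fun j l => u j l * ψ j l) 𝔫 h𝔫 hψ₂ hcoc₂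
    (fun j l => G j l + ((e.symm 1 : ↥(J.restrictScalars k)) : R) ⊗ₜ (g j l * h j l)) hG'coc hG'u s₂ hs₂
  -- brick B8: the moved lift reduces to `ψ'`; the corrected units reduce to `G₀`
  have hψσ₂ : ∀ j l x, Algebra.TensorProduct.map σ (AlgHom.id k Γ(X.left, (U j).1 ⊓ (U l).1)) ((u j l * ψ j l) x) =
      ψ' j l (Algebra.TensorProduct.map σ (AlgHom.id k Γ(X.left, (U j).1 ⊓ (U l).1)) x) := by
    intro j l x
    rw [AlgEquiv.mul_apply, ← hψσ j l x, ← sub_eq_zero, ← map_sub, ← mem_smul_top_iff_map_eq_zero σ hσ, hJσ']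
    exact huJ j l (ψ j l x)
  have hG'σ : ∀ j l, Algebra.TensorProduct.map σ (AlgHom.id k Γ(X.left, (U j).1 ⊓ (U l).1))
      (G j l + ((e.symm 1 : ↥(J.restrictScalars k)) : R) ⊗ₜ (g j l * h j l)) = G₀ j l := fun j l => by
    rw [map_add_tmul_of_map_eq_zero σ ht, hGσ]
  refine ⟨u, huJ, hψ₂, hcoc₂, L, hL, hψσ₂, fun Φ hΦ => ?_⟩
  -- ★ D1-B
  exact nonempty_pullback_iso_of_overlapSections halg σ U b hb (fun j l => u j l * ψ j l) ψ' 𝔫 h𝔫 𝔫' h𝔫' hψ₂ hψ' hcoc₂ hcoc'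
    (fun j l => G j l + ((e.symm 1 : ↥(J.restrictScalars k)) : R) ⊗ₜ (g j l * h j l)) Φ hΦ s₂ hs₂ s₀
    (fun j l => by rw [hG'σ]; exact hs₀ j l) L e₂ he₂ M fM hfM

end LB

end Literature.AlgebraicGeometry.Deformation

end
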